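import Mathlib
import Literature.MathematicalPhysics.QuantumFieldTheory.MagnenRivasseauSeneor1993.MRS93WindowGaussian
import HarnessLib

/-!
# Magnen–Rivasseau–Sénéor (CMP 155, 1993), Sect. II.F (II.66)–(II.73) p.344–345: the GHOST RE-INTEGRATION by
# completing the square, now for the tree's own Gaussian measure `dν_{ρ₂}(γ)` on every finite window of independent
# ghost modes — gen 6's READING (FD) identity (`GhostGaussian.gaussExpect_completing_square`) composed with gen 6's
# window theorem (`integral_nu_window`), and the window normalisation in the printed determinant form
# «(det(1 + ζΓU²))^{1/2}» of p.345 tl.14–17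

statement-level skeleton of published displays with citation tags; the finite-window identities proved; nothing here is
a claim about the Yang–Mills mass gap, about continuum Yang–Mills on `T⁴` without infrared cutoff, or about the Clay
problem — and nothing of Magnen–Rivasseau–Sénéor's expansion or estimates is asserted or formalised

**Citation header (reproduction of PUBLISHED work).** J. Magnen, V. Rivasseau, R. Sénéor, *Construction of YM₄ with
an infrared cutoff*, Commun. Math. Phys. **155** (1993) 325–383 [MagnenRivasseauSeneor1993], Sect. II.F (II.66) p.344 tl.13–14,
p.344 tl.23–29, (II.70)–(II.73) p.344–345, p.345 tl.2–17; (II.36) p.339 tl.22–24 (the measure `dν_{ρ₂}`). Loci `p.NNN tl.nn` = journal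
page / text-layer line of the held scan `paper:magnen1993-cmp155-mrs-ym4-infrared-cutoff` (PDF page = journal page −
324); displays as read by gen 6 on the decoded page images (renders of record `run/shared/lean/pub/lit-balaban/
inprint/lit-balaban-p14/renders-cmp155/p20_full_s6.png`, `p21_full_s6.png`). Cell pub-balaban-gaps (YM blitz, track
G3), seat mrs-lit-1 (gen 10); companion prose `run/shared/lean/pub/pub-balaban-gaps/g3/MRS-AS-PRINTED.md` §2, §5 (gen
6's successor list, item (ii): the glue of (II.66) for the tree's ν with the (II.73)/(II.76) form). Builds BY
NAME, re-declaring nothing, on `…MRS93GhostReintegration` (gen 6: `GhostGaussian.csMat` = ζUᵀU + Γ⁻¹, `csVec`,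
`Omega` = (II.72), `gaussZ`, `gaussExpect`, **`gaussExpect_completing_square`** = (II.73) in READING (FD),
`posDef_csMat`, `isUnit_det_csMat`, `gaussZ_pos`, `gaussZ_ratio`, `det_csMat_mul_propagator`, `Krr`,
`Krr_csMat_eq_of_posDef`) and on `…MRS93WindowGaussian` (gen 6: `GhostGaussian.diagInv`, **`integral_nu_window`** —
READING (FD) PROVED for the tree's `nu` on windows of positive live modes).

**What the paper prints (verbatim, from the page images; the same blocks as gen 6's `…MRS93GhostReintegration`).**
* p.344 tl.13–14: *«With these notations: K_{ρ₂}(A′,γ) = ∫dν_{ρ₂}(γ′) e^{−Σ_i(λ^{1/2+2ε₂}γ′^i)^N} ×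
  e^{−(ζ/2)(∇_{RB,γ′−γ}·(A′_s+D(A′_s)(γ′−γ)))²} e^{−(ζ/2)Σ(A′,γ,γ′)}. (II.66)»*
* p.344 tl.23–29: *«Again we write (U + V + ∇_{RB,γ′−γ}·A′_s)² = (U + ∇_{RB,γ′−γ}·A′_s)² + W, W ≡ 2V·(U + ∇_{RB,γ′−γ}·A′_s)
  + V² (II.70) (to simplify these formulas we write them like squares instead of scalar products, and we omit the
  necessary transpositions of operators, which are straightforward). Since V is small (with a factor λ²), we can treat
  Σ + W in the integral over γ′ as a complicated interaction, and we group together the measure dν_{ρ₂}(γ′) with the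
  main quadratic piece (ζ/2)⟨γ′ − γ, UᵗʳU(γ′ − γ)⟩. Again we write U² for UᵗʳU, etc.»*
* p.345 tl.2–13: *«Therefore we define a new Gaussian variable γ″ which has propagator (ζU² + Γ⁻¹)⁻¹ and which is
  defined by: γ″ = γ′ − γ + (ζU(∇_{RB,γ′−γ}·A′_s) + Γ⁻¹γ)/(ζU² + Γ⁻¹). (II.71) We define also Ω ≡ (ζU(∇_{RB,γ′−γ}·A′_s) +
  Γ⁻¹γ)²/(ζU² + Γ⁻¹) − ζ(∇_{RB,γ′−γ}·A′_2)² − γΓ⁻¹γ. (II.72) [«A′_2» sic, for A′_s] We see that Ω is small as Γ⁻¹ when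
  Γ⁻¹ → 0. This is the reason for which we can treat it as an interaction … Now we obtain, rewriting everything in terms
  of γ″, K_{ρ₂}(A′,γ) = (det (ζU² + Γ⁻¹)/Γ⁻¹)^{−1/2} ∫dπ_{ρ₂}(γ″) × e^{−Σ_i(λ^{1/2+2ε₂}κ^i(γ′(γ″,γ)))^N}
  e^{−(ζ/2)(Σ+W+Ω)(A′,γ,γ′(γ,γ″))} (II.73) by completing the square.»*; tl.14–17: *«The determinant (det (ζU²+Γ⁻¹)/Γ⁻¹)^{1/2}
  = (det(1 + ζΓU²))^{1/2} which appears in K_{ρ₂}(A)⁻¹ is the analogue of the Fadeev-Popov determinant (up to the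
  constant normalization det Γ⁻¹).»*
* (II.36) p.339 tl.22–24: *«The Gaussian measure on γ with covariance Γ_{ρ₂} is called dν_{ρ₂}(γ)»*.

**What is typed here (the identities kernel-checked; zero `sorry`, zero named facts).** For a finite window `W` of
ghost modes with POSITIVE momenta (independent real coordinates of the real field `γ`: `γ̃(−p) = conj γ̃(p)`) and live
variances (`Γ_{ρ₂} ≠ 0` on `W`), the tree's measure `nu par ρ₂` = dν_{ρ₂} restricted to `W` IS the (FD) Gaussian with
`Γ⁻¹ = diag(Γ_{ρ₂}|_W⁻¹)` (gen 6); here: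
* §1 `posDef_diagInv` (`diag(v⁻¹) ≻ 0` for live variances), `isSymm_of_posDef'`, `gaussExpect_one`; the main piece
  `mainPiece ζ U c γ₀ γ′ = e^{−(ζ/2)‖U(γ′ − γ₀) + c‖²}` of (II.66)/(II.70) as a function of the window coordinates, for ANY
  real rectangular matrix `U : Matrix κ W ℝ` and source `c : κ → ℝ` (READING (U) below), `measurable_mainPiece`.
* §2 **`integral_nu_mainPiece_window`** — (II.66) → (II.73) FOR THE TREE'S `dν_{ρ₂}`: for `ζ ≥ 0` and measurable `F`,
  `∫ e^{−(ζ/2)‖U(γ|_W − γ₀) + c‖²} F(γ|_W) dν_{ρ₂}(γ) = (Z(M)/Z(Γ⁻¹))·e^{Ω/2}·∫dπ_M(y) F(y + γ₀ − M⁻¹b)` with `M = ζUᵀU +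
  Γ⁻¹` (`csMat`), `b = ζUᵀc + Γ⁻¹γ₀` (`csVec`), `Ω` = (II.72) (`Omega`) — gen 6's (FD) identity instantiated on the actual
  measure; **`integral_nu_mainPiece_window_eq_Krr`** — the same in the (II.76) form `K_rr` of gen 6.
* §3 **`integral_nu_mainPiece_window_eq_det`** — THE WINDOW NORMALISATION IN THE PRINTED DETERMINANT FORM: with `F ≡
  1`, `∫ e^{−(ζ/2)‖U(γ|_W − γ₀) + c‖²} dν_{ρ₂}(γ) = (det(1 + ζΓU ᵀU))^{−1/2}·e^{Ω/2}` («(det(1 + ζΓU²))^{1/2} … the analogue of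
  the Fadeev-Popov determinant», p.345 tl.14–17, for the tree's `dν_{ρ₂}` on the window; `Γ = diag(Γ_{ρ₂}|_W)`);
  `integral_nu_mainPiece_window_pos` (it is `> 0`).

**Readings (declared).** (FD)/(W+) as gen 6: finite windows of positive live modes (the natural independent
coordinates of a real field; arbitrary windows go through gen 6's `…_rep` theorems and are not restated). (U) the
operator `U` of (II.68)/(II.70) enters as an ABSTRACT real matrix on the window coordinates and the source
`∇_{RB,γ′−γ}·A′_s` as an abstract vector `c`, frozen (gen 6's caveat: in print `c` depends on `γ′` through `RB`,
p.344; the Gaussian step holds with `c` frozen and the print moves the rest into `Σ`/`W` without displaying it); the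
identification of `U` with the window matrix of gen 5's `MainStatement.uOp` is NOT typed in v1 (it is re/im
bookkeeping of `sqNormBox`, gen 6's list (ii)) — it IS typed in the v1.1 APPEND below (§4–§6: `reImMatrix`,
`integral_nu_expSqNormBox_uOp`), so v1 alone is the glue of the (FD) identity with the tree's ν. (Z) `ζ ≥ 0` (the print's `ζ` is «close to 3/13»).

**Honest status / what is NOT claimed.** Nothing about `K_{ρ,ρ₂}` (II.76) beyond gen 6's `κ_ρ ≡ 1` identification;
nothing about the damping factor or `χ`; no estimate; nothing of MRS's expansion; not continuum YM₄ on `T⁴` without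
infrared cutoff; not Clay.
-/

noncomputable section

open MeasureTheory Finset
open scoped NNReal ENNReal Matrix

namespace Literature.MathematicalPhysics.QuantumFieldTheory.MagnenRivasseauSeneor1993

namespace MainStatement

namespace GhostWindow

open GhostGaussian ProbabilityTheory

variable {ι κ : Type*} [Fintype ι] [DecidableEq ι] [Fintype κ]

/-! ## §1 Plumbing: `diag(v⁻¹) ≻ 0`, the main piece of (II.66)/(II.70) on window coordinates -/

omit [Fintype ι] in
/-- `Γ⁻¹ = diag(v⁻¹)` is positive definite when every variance is live (`v_i ≠ 0`, hence `> 0`).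
[cite: MagnenRivasseauSeneor1993, (II.36) p.339 tl.22–24, (II.73) p.345] -/
theorem posDef_diagInv (v : ι → ℝ≥0) (hv : ∀ i, v i ≠ 0) : (diagInv v).PosDef := by
  unfold diagInv
  rw [Matrix.posDef_diagonal_iff]
  intro i
  exact inv_pos.mpr (lt_of_le_of_ne (v i).2 (fun h => hv i (by ext; exact h.symm)))

omit [Fintype ι] [DecidableEq ι] in
/-- A real positive definite matrix is symmetric (gen 6 keeps this private; restated for use here).
[cite: MagnenRivasseauSeneor1993, p.344 tl.25–26 «the necessary transpositions»] -/
theorem isSymm_of_posDef' {Q : Matrix ι ι ℝ} (hQ : Q.PosDef) : Q.IsSymm := by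
  have h := hQ.isHermitian
  rw [Matrix.IsHermitian, Matrix.conjTranspose_eq_transpose_of_trivial] at h
  exact h

omit [DecidableEq ι] in
/-- `∫dπ_Q 1 = 1` for the normalised expectation (`Z(Q) ≠ 0`). [cite: MagnenRivasseauSeneor1993, (II.73) p.345 tl.9–10] -/
theorem gaussExpect_one {Q : Matrix ι ι ℝ} (hZ : gaussZ Q ≠ 0) : gaussExpect Q (fun _ => (1 : ℝ)) = 1 := by
  unfold gaussExpect
  simp only [mul_one]
  exact inv_mul_cancel₀ hZ

/-- **The main piece of (II.66)/(II.70)** on the window coordinates: `e^{−(ζ/2)‖U(γ′ − γ₀) + c‖²}` for a real rectangular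
`U` (READING (U)) and a frozen source `c`. [cite: MagnenRivasseauSeneor1993, (II.66) p.344, (II.70) p.344 tl.30–35] -/
def mainPiece (ζ : ℝ) (U : Matrix κ ι ℝ) (c : κ → ℝ) (γ₀ : ι → ℝ) (γ' : ι → ℝ) : ℝ :=
  Real.exp (-(ζ / 2) * ((U *ᵥ (γ' - γ₀) + c) ⬝ᵥ (U *ᵥ (γ' - γ₀) + c)))

omit [DecidableEq ι] in
/-- The main piece is measurable in `γ′`. [cite: MagnenRivasseauSeneor1993, (II.66) p.344] -/
theorem measurable_mainPiece (ζ : ℝ) (U : Matrix κ ι ℝ) (c : κ → ℝ) (γ₀ : ι → ℝ) : Measurable (mainPiece ζ U c γ₀) := by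
  unfold mainPiece
  refine Real.measurable_exp.comp (Measurable.const_mul ?_ _)
  have h : Continuous fun γ' : ι → ℝ => (U *ᵥ (γ' - γ₀) + c) ⬝ᵥ (U *ᵥ (γ' - γ₀) + c) := by
    unfold dotProduct Matrix.mulVec
    fun_prop
  exact h.measurable

omit [DecidableEq ι] in
/-- The main piece is positive. [cite: MagnenRivasseauSeneor1993, (II.66) p.344] -/
theorem mainPiece_pos (ζ : ℝ) (U : Matrix κ ι ℝ) (c : κ → ℝ) (γ₀ γ' : ι → ℝ) : 0 < mainPiece ζ U c γ₀ γ' :=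
  Real.exp_pos _

/-! ## §2 (II.66) → (II.73) for the tree's `dν_{ρ₂}` on a window of positive live modes -/

/-- **(II.73) FOR THE TREE'S MEASURE.** On a finite window `W` of ghost modes with positive momenta and live variances,
for `ζ ≥ 0`, any real `U : Matrix κ W ℝ`, source `c`, shift `γ₀` and measurable `F`:
`∫ e^{−(ζ/2)‖U(γ|_W − γ₀) + c‖²} F(γ|_W) dν_{ρ₂}(γ) = (Z(M)/Z(Γ⁻¹))·e^{Ω/2}·∫dπ_M(y) F(y + γ₀ − M⁻¹b)`, `M = ζUᵀU + Γ⁻¹`,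
`b = ζUᵀc + Γ⁻¹γ₀`, `Γ⁻¹ = diag(Γ_{ρ₂}|_W⁻¹)` — gen 6's completing-the-square identity instantiated on `nu par ρ₂`.
[cite: MagnenRivasseauSeneor1993, (II.66) p.344, (II.71)–(II.73) p.345 tl.3–13, (II.36) p.339 tl.22–24] -/
theorem integral_nu_mainPiece_window (par : Parameters) (ρ₂ : ℕ) (W : Finset GhostMode) (hW : ∀ m ∈ W, m.1.IsPos)
    (hv : ∀ m : W, par.nuVariance ρ₂ m ≠ 0) {ζ : ℝ} (hζ : 0 ≤ ζ) (U : Matrix κ W ℝ) (c : κ → ℝ) (γ₀ : W → ℝ)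
    {F : (W → ℝ) → ℝ} (hF : Measurable F) :
    ∫ γ, mainPiece ζ U c γ₀ (W.restrict γ) * F (W.restrict γ) ∂(nu par ρ₂) =
      (gaussZ (csMat ζ U (diagInv fun m : W => par.nuVariance ρ₂ m)) /
          gaussZ (diagInv fun m : W => par.nuVariance ρ₂ m)) *
        Real.exp (Omega ζ U (diagInv fun m : W => par.nuVariance ρ₂ m) c γ₀ / 2) *
        gaussExpect (csMat ζ U (diagInv fun m : W => par.nuVariance ρ₂ m))
          (fun y => F (y + (γ₀ - (csMat ζ U (diagInv fun m : W => par.nuVariance ρ₂ m))⁻¹ *ᵥ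
            csVec ζ U (diagInv fun m : W => par.nuVariance ρ₂ m) c γ₀))) := by
  set Γinv := diagInv fun m : W => par.nuVariance ρ₂ m with hΓ
  have hPD : Γinv.PosDef := posDef_diagInv _ hv
  have h1 := integral_nu_window par ρ₂ W hW hv (G := fun y => mainPiece ζ U c γ₀ y * F y)
    ((measurable_mainPiece ζ U c γ₀).mul hF)
  rw [h1]
  exact gaussExpect_completing_square ζ U (isSymm_of_posDef' hPD) (isUnit_det_csMat hζ U hPD)
    (gaussZ_pos (posDef_csMat hζ U hPD)).ne' c γ₀ F

/-- **The same in the (II.76) form of gen 6**: `∫ e^{−(ζ/2)‖U(γ|_W − γ₀) + c‖²} F(γ|_W) dν_{ρ₂}(γ) = K_rr(M, Γ⁻¹)[e^{Ω/2}F(· +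
γ₀ − M⁻¹b)]` (`GhostGaussian.Krr`, the `κ_ρ ≡ 1` form of `[K_{ρ,ρ₂}]`).
[cite: MagnenRivasseauSeneor1993, (II.73) p.345, (II.76) p.346] -/
theorem integral_nu_mainPiece_window_eq_Krr (par : Parameters) (ρ₂ : ℕ) (W : Finset GhostMode)
    (hW : ∀ m ∈ W, m.1.IsPos) (hv : ∀ m : W, par.nuVariance ρ₂ m ≠ 0) {ζ : ℝ} (hζ : 0 ≤ ζ) (U : Matrix κ W ℝ)
    (c : κ → ℝ) (γ₀ : W → ℝ) {F : (W → ℝ) → ℝ} (hF : Measurable F) :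
    ∫ γ, mainPiece ζ U c γ₀ (W.restrict γ) * F (W.restrict γ) ∂(nu par ρ₂) =
      Krr (csMat ζ U (diagInv fun m : W => par.nuVariance ρ₂ m)) (diagInv fun m : W => par.nuVariance ρ₂ m)
        (fun y => Real.exp (Omega ζ U (diagInv fun m : W => par.nuVariance ρ₂ m) c γ₀ / 2) *
          F (y + (γ₀ - (csMat ζ U (diagInv fun m : W => par.nuVariance ρ₂ m))⁻¹ *ᵥ
            csVec ζ U (diagInv fun m : W => par.nuVariance ρ₂ m) c γ₀))) := by
  have hPD : (diagInv fun m : W => par.nuVariance ρ₂ m).PosDef := posDef_diagInv _ hv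
  have h1 := integral_nu_window par ρ₂ W hW hv (G := fun y => mainPiece ζ U c γ₀ y * F y)
    ((measurable_mainPiece ζ U c γ₀).mul hF)
  rw [h1]
  exact (Krr_csMat_eq_of_posDef hζ U hPD c γ₀ F).symm

/-! ## §3 The window normalisation in the printed determinant form «(det(1 + ζΓU²))^{−1/2}» -/

/-- **THE WINDOW NORMALISATION, CLOSED FORM:** `∫ e^{−(ζ/2)‖U(γ|_W − γ₀) + c‖²} dν_{ρ₂}(γ) = (det(1 + ζΓUᵀU))^{−1/2}·e^{Ω/2}`
with `Γ = diag(Γ_{ρ₂}|_W)` — «(det (ζU²+Γ⁻¹)/Γ⁻¹)^{1/2} = (det(1 + ζΓU²))^{1/2} which appears in K_{ρ₂}(A)⁻¹ is the analogue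
of the Fadeev-Popov determinant», now for the tree's `dν_{ρ₂}` on the window.
[cite: MagnenRivasseauSeneor1993, p.345 tl.14–17, (II.73) p.345, (II.37)/(II.55) pp.339/343] -/
theorem integral_nu_mainPiece_window_eq_det (par : Parameters) (ρ₂ : ℕ) (W : Finset GhostMode)
    (hW : ∀ m ∈ W, m.1.IsPos) (hv : ∀ m : W, par.nuVariance ρ₂ m ≠ 0) {ζ : ℝ} (hζ : 0 ≤ ζ) (U : Matrix κ W ℝ)
    (c : κ → ℝ) (γ₀ : W → ℝ) :
    ∫ γ, mainPiece ζ U c γ₀ (W.restrict γ) ∂(nu par ρ₂) =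
      (Real.sqrt (Matrix.det (1 + ζ • ((diagInv fun m : W => par.nuVariance ρ₂ m)⁻¹ * (Uᵀ * U)))))⁻¹ *
        Real.exp (Omega ζ U (diagInv fun m : W => par.nuVariance ρ₂ m) c γ₀ / 2) := by
  set Γinv := diagInv fun m : W => par.nuVariance ρ₂ m with hΓ
  have hPD : Γinv.PosDef := posDef_diagInv _ hv
  have h := integral_nu_mainPiece_window par ρ₂ W hW hv hζ U c γ₀ (F := fun _ => (1 : ℝ)) measurable_const
  simp only [mul_one] at h
  rw [h, gaussExpect_one (gaussZ_pos (posDef_csMat hζ U hPD)).ne', mul_one, gaussZ_ratio hζ U hPD,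
    det_csMat_mul_propagator ζ U (isUnit_iff_ne_zero.mpr hPD.det_pos.ne')]

/-- The window normalisation is positive. [cite: MagnenRivasseauSeneor1993, p.340 tl.12–14 «K_{ρ₂}(A) is well defined», (II.73) p.345] -/
theorem integral_nu_mainPiece_window_pos (par : Parameters) (ρ₂ : ℕ) (W : Finset GhostMode)
    (hW : ∀ m ∈ W, m.1.IsPos) (hv : ∀ m : W, par.nuVariance ρ₂ m ≠ 0) {ζ : ℝ} (hζ : 0 ≤ ζ) (U : Matrix κ W ℝ)
    (c : κ → ℝ) (γ₀ : W → ℝ) :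
    0 < ∫ γ, mainPiece ζ U c γ₀ (W.restrict γ) ∂(nu par ρ₂) := by
  have hPD : (diagInv fun m : W => par.nuVariance ρ₂ m).PosDef := posDef_diagInv _ hv
  have h := integral_nu_mainPiece_window par ρ₂ W hW hv hζ U c γ₀ (F := fun _ => (1 : ℝ)) measurable_const
  simp only [mul_one] at h
  rw [h, gaussExpect_one (gaussZ_pos (posDef_csMat hζ U hPD)).ne', mul_one]
  exact mul_pos (div_pos (gaussZ_pos (posDef_csMat hζ U hPD)) (gaussZ_pos hPD)) (Real.exp_pos _)

end GhostWindow

/-!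
# v1.1 APPEND (gen 12): READING (U) DISCHARGED — the printed operator `U(A′_s, B′_l)` of (II.68), applied to the cut-off
# ghost field, IS a real rectangular matrix on the independent window coordinates, and (II.66) → (II.73) holds for it

(Appended to this file; v1 above is kept byte-for-byte except the one docstring sentence that announced this item.)

**What the paper prints (verbatim, the blocks of v1 and of gen 5's `…MRS93BackgroundGaugeFixing`).** p.344 tl.19 with
(II.68): *«U(A′_s, B′_l) ≡ ∂² − λ∂[A′_s, .] − λΣ_i[κ_j ∗ B′_l, κ^j ∗ ∂.] , (II.68)»* (the index printed under `Σ` is «i»,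
the summand's is «j» — 2× crop `run/shared/lean/pub/pub-balaban-gaps/pub-balaban-gaps-mrs-lit-1/g12/p20_crop_r2700-4100_s2.png`;
gen 5 writes `Σ_j`); p.344 tl.27–29: *«we group together the
measure dν_{ρ₂}(γ′) with the main quadratic piece (ζ/2)⟨γ′ − γ, UᵗʳU(γ′ − γ)⟩. Again we write U² for UᵗʳU, etc.»*; p.345
tl.1–2: *«Therefore we define a new Gaussian variable γ″ which has propagator (ζU² + Γ⁻¹)⁻¹»*; p.328 tl.37–42 (the pairing
`⟨·,·⟩`: «minus a trace over group indices, so that it is positive definite with a factor 1/2 in component notation»).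

**What is appended (everything PROVED; zero `sorry`, zero new named facts).** v1 proved (II.66) → (II.73) for the tree's
`dν_{ρ₂}` with `U` an ABSTRACT real matrix on the window coordinates (READING (U)). Here:
* §4 `reImVec`, **`reImMatrix`** (the real/imaginary-part matrix of an `ℝ`-linear map into `K → ℂ`), `reImMatrix_mulVec`,
  `sum_normSq_eq_dotProduct`, **`sum_normSq_affine`** (`Σ_k |f(y)_k + c_k|² = ‖R y + d‖²` with `R = reImMatrix f`,
  `d = reImVec c`): the re/im bookkeeping of gen 5's `sqNormBox` in closed form.
* §5 the ghost window `ghostWindow Sγ` (ALL modes over the momentum window, both signs of `p`), the read-out `gcoeffW` of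
  `γ̃` from the window coordinates (`gcoeffZ_eq_gcoeffW`: `γ̃` depends on `γ` only through the window), its linearity, the
  linear read-out `readOutW` of `k ↦ L(γ̃)(k)` on a momentum box for ANY additive, `ℝ`-homogeneous operator `L` on
  coefficient functions, the realified read-out `readOut = readOutW ∘ realifyWindow` on the INDEPENDENT coordinates
  (gen 6's `realifyWindow`: the modes at `−p` are `±` those at `p`), and **`sqNormBox_linear_eq`**:
  `sqNormBox box (L(γ̃′) + c) = ½‖R y + d‖²` at `γ′ =` the realified configuration of `y`, `R = reImMatrix readOut`.
* §6 **`integral_nu_expSqNormBox`** — for every momentum window `Sγ` with live variances on the representatives, every box,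
  every such `L`, source `c`, `ζ`, measurable `F`:
  `∫ e^{−(ζ/2)·sqNormBox box (L(γ̃′) + c)} F(γ′|_W) dν_{ρ₂}(γ′) = ∫dπ_{Γ⁻¹}(y) e^{−((ζ/2)/2)‖R y + d‖²} F(realifyWindow y)` —
  i.e. the main quadratic piece of (II.66) IS v1's `mainPiece (ζ/2) R d 0` (the `½` of the p.328 pairing «in component
  notation» moves into `ζ/2`; equivalently `U = R/√2` with `ζ`); **`integral_nu_expSqNormBox_eq_cs`** — hence (II.73) by
  gen 6's `gaussExpect_completing_square` with `M = (ζ/2)RᵀR + Γ⁻¹`, `Ω`, `b` explicit; **`integral_nu_expSqNormBox_eq_det`**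
  — the normalisation `(det(1 + (ζ/2)ΓRᵀR))^{−1/2}·e^{Ω/2}` (p.345 tl.14–17); and the instances **`integral_nu_expSqNormBox_uOp`**
  / `…_uOp_eq_det` for `L = U(A′_s, B′_l)` of (II.68) ITSELF (linear by gen 5's `uOp_add`/`uOp_smul`), box `box4 T`, `ζ = par.ζ`.

**Readings (declared).** (FD)/(W+) as v1 and gen 6. (U′) replaces (U): `U` is gen 5's `uOp` read through `γ̃′ = gcoeffZ Sγ γ′`;
the source `c` (in print `∇_{RB,γ′−γ}·A′_s − U(A′_s,B′_l)γ̃`, and gen 6's `V`, `W`, `Σ` corrections) stays FROZEN / outside —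
gen 6's caveat on the `γ′`-dependence of `∇_{RB,γ′−γ}` through `RB` is untouched. (Z′) `ζ` arbitrary in §6's first
identity; `ζ ≥ 0` for the completed square. Nothing is claimed about `K_{ρ,ρ₂}`, the damping factor, `χ`, or any estimate.
-/

namespace GhostWindow

open GhostGaussian ProbabilityTheory

/-! ## §4 (v1.1) Re/Im bookkeeping: `Σ_k |f(y)_k + c_k|²` as the squared norm of a REAL affine image -/

section ReIm

variable {W K : Type*} [Fintype W] [DecidableEq W] [Fintype K]

/-- Real and imaginary parts of a complex vector as one real vector on `K × Bool` (`false` ↦ Re, `true` ↦ Im).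
[cite: MagnenRivasseauSeneor1993, §II.A p.328 tl.12–17, tl.37–42] -/
def reImVec (v : K → ℂ) : K × Bool → ℝ := fun kb => if kb.2 then (v kb.1).im else (v kb.1).re

omit [Fintype K] in
/-- `reImVec` is additive. [cite: MagnenRivasseauSeneor1993, §II.A p.328] -/
theorem reImVec_add (v w : K → ℂ) : reImVec (v + w) = reImVec v + reImVec w := by
  funext kb
  rcases kb with ⟨k, b⟩
  cases b <;> simp [reImVec]

/-- `Σ_k |v_k|² = ‖reImVec v‖²` (`|z|² = (Re z)² + (Im z)²`). [cite: MagnenRivasseauSeneor1993, §II.A p.328 tl.37–42] -/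
theorem sum_normSq_eq_dotProduct (v : K → ℂ) : ∑ k, Complex.normSq (v k) = reImVec v ⬝ᵥ reImVec v := by
  simp only [dotProduct, Fintype.sum_prod_type, Fintype.sum_bool, reImVec, Complex.normSq_apply]
  simp only [Bool.false_eq_true, ↓reduceIte]
  refine Finset.sum_congr rfl fun k _ => ?_
  ring

/-- **The Re/Im MATRIX of an `ℝ`-linear map into `K → ℂ`**: its column at the coordinate `m` is `reImVec (f e_m)`.
[cite: MagnenRivasseauSeneor1993, (II.68) p.344 tl.19, p.344 tl.27–29] -/
def reImMatrix (f : (W → ℝ) →ₗ[ℝ] (K → ℂ)) : Matrix (K × Bool) W ℝ :=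
  fun kb m => reImVec (f fun j => if m = j then 1 else 0) kb

omit [Fintype K] in
/-- `reImMatrix f · y = reImVec (f y)` — the matrix represents the map. [cite: MagnenRivasseauSeneor1993, (II.68) p.344] -/
theorem reImMatrix_mulVec (f : (W → ℝ) →ₗ[ℝ] (K → ℂ)) (y : W → ℝ) : reImMatrix f *ᵥ y = reImVec (f y) := by
  funext kb
  rw [LinearMap.pi_apply_eq_sum_univ f y]
  rcases kb with ⟨k, b⟩
  simp only [Matrix.mulVec, dotProduct, reImMatrix, reImVec, Finset.sum_apply, Pi.smul_apply, Complex.real_smul]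
  cases b
  · simp only [Bool.false_eq_true, ↓reduceIte, Complex.re_sum, Complex.re_ofReal_mul]
    exact Finset.sum_congr rfl fun m _ => mul_comm _ _
  · simp only [ite_true, Complex.im_sum, Complex.im_ofReal_mul]
    exact Finset.sum_congr rfl fun m _ => mul_comm _ _

/-- **`Σ_k |f(y)_k + c_k|² = ‖R y + d‖²`** with `R = reImMatrix f`, `d = reImVec c` — a complex affine image has the squared
norm of a REAL affine image. [cite: MagnenRivasseauSeneor1993, p.344 tl.27–29, §II.A p.328 tl.37–42] -/
theorem sum_normSq_affine (f : (W → ℝ) →ₗ[ℝ] (K → ℂ)) (c : K → ℂ) (y : W → ℝ) :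
    ∑ k, Complex.normSq ((f y + c) k) =
      (reImMatrix f *ᵥ y + reImVec c) ⬝ᵥ (reImMatrix f *ᵥ y + reImVec c) := by
  rw [reImMatrix_mulVec, ← reImVec_add]
  exact sum_normSq_eq_dotProduct (f y + c)

end ReIm

/-! ## §5 (v1.1) The ghost window, the read-out of `γ̃` from its coordinates, and `sqNormBox (L(γ̃′) + c)` in closed form -/

/-- ALL ghost modes over the momentum window `Sγ` (momenta of both signs, three colours, Re/Im).
[cite: MagnenRivasseauSeneor1993, (II.36) p.339 tl.22–27, §II.A p.328 tl.12–17] -/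
def ghostWindow (Sγ : Finset Momentum) : Finset GhostMode := Sγ ×ˢ Finset.univ

/-- Membership in the ghost window is membership of the momentum. [cite: MagnenRivasseauSeneor1993, (II.36) p.339] -/
theorem mem_ghostWindow {Sγ : Finset Momentum} {m : GhostMode} : m ∈ ghostWindow Sγ ↔ m.1 ∈ Sγ := by
  simp [ghostWindow]

/-- The mode `(p, a, b)` of the window, as an element of the window. [cite: MagnenRivasseauSeneor1993, (II.36) p.339] -/
def windowMode {Sγ : Finset Momentum} (p : Momentum) (hp : p ∈ Sγ) (a : Fin 3) (b : Bool) : ghostWindow Sγ :=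
  ⟨(p, a, b), mem_ghostWindow.mpr hp⟩

/-- `γ̃` READ FROM THE WINDOW COORDINATES: `γ̃^a(k) = x(k, a, Re) + i·x(k, a, Im)` for `k ∈ Sγ`, zero outside and at `k = 0`.
[cite: MagnenRivasseauSeneor1993, (II.36) p.339 tl.22–27, §II.A p.328 tl.12–15] -/
def gcoeffW (Sγ : Finset Momentum) (x : ghostWindow Sγ → ℝ) : GCoeff := fun k a =>
  if h : k = 0 then 0 else
    if hp : (⟨k, h⟩ : Momentum) ∈ Sγ then
      (x (windowMode ⟨k, h⟩ hp a false) : ℂ) + (x (windowMode ⟨k, h⟩ hp a true) : ℂ) * Complex.I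
    else 0

/-- **`γ̃` depends on `γ` only through the window**: `gcoeffZ Sγ γ = gcoeffW Sγ (γ|_{ghostWindow Sγ})`.
[cite: MagnenRivasseauSeneor1993, (II.36) p.339 tl.22–27] -/
theorem gcoeffZ_eq_gcoeffW (Sγ : Finset Momentum) (γ : GhostConfig) :
    gcoeffZ Sγ γ = gcoeffW Sγ ((ghostWindow Sγ).restrict γ) := by
  funext k a
  unfold gcoeffZ gcoeffW gcoeff windowMode
  split_ifs <;> rfl

/-- The read-out is additive … [cite: MagnenRivasseauSeneor1993, (II.36) p.339] -/
theorem gcoeffW_add (Sγ : Finset Momentum) (x₁ x₂ : ghostWindow Sγ → ℝ) :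
    gcoeffW Sγ (x₁ + x₂) = gcoeffW Sγ x₁ + gcoeffW Sγ x₂ := by
  funext k a
  simp only [gcoeffW, Pi.add_apply]
  split_ifs <;> push_cast <;> ring

/-- … and `ℝ`-homogeneous. [cite: MagnenRivasseauSeneor1993, (II.36) p.339] -/
theorem gcoeffW_smul (Sγ : Finset Momentum) (r : ℝ) (x : ghostWindow Sγ → ℝ) :
    gcoeffW Sγ (r • x) = r • gcoeffW Sγ x := by
  funext k a
  simp only [gcoeffW, Pi.smul_apply, smul_eq_mul, Complex.real_smul]
  split_ifs <;> push_cast <;> ring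

/-- gen 6's `realifyWindow` is additive … [cite: MagnenRivasseauSeneor1993, §II.A p.328 tl.12–17] -/
theorem realifyWindow_add {L : Type*} [DecidableEq L] (im : L → Bool) (W : Finset (Momentum × L)) (y₁ y₂ : ↥(W.image rep) → ℝ) :
    realifyWindow im W (y₁ + y₂) = realifyWindow im W y₁ + realifyWindow im W y₂ := by
  funext m
  simp only [realifyWindow, Pi.add_apply]
  ring

/-- … and `ℝ`-homogeneous. [cite: MagnenRivasseauSeneor1993, §II.A p.328 tl.12–17] -/
theorem realifyWindow_smul {L : Type*} [DecidableEq L] (im : L → Bool) (W : Finset (Momentum × L)) (r : ℝ) (y : ↥(W.image rep) → ℝ) :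
    realifyWindow im W (r • y) = r • realifyWindow im W y := by
  funext m
  simp only [realifyWindow, Pi.smul_apply, smul_eq_mul]
  ring

/-- **THE LINEAR READ-OUT ON A MOMENTUM BOX**: for an additive, `ℝ`-homogeneous operator `L` on coefficient functions
(e.g. `U(A′_s, B′_l)` of (II.68)), `x ↦ ((k, a) ↦ L(γ̃(x))^a(k))` on `k ∈ box` is an `ℝ`-LINEAR map of the window
coordinates. [cite: MagnenRivasseauSeneor1993, (II.68) p.344 tl.19, p.344 tl.27–29] -/
def readOutW (Sγ : Finset Momentum) (box : Finset (Fin 4 → ℤ)) (L : GCoeff → GCoeff)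
    (hadd : ∀ η₁ η₂, L (η₁ + η₂) = L η₁ + L η₂) (hsmul : ∀ (r : ℝ) η, L (r • η) = r • L η) :
    (ghostWindow Sγ → ℝ) →ₗ[ℝ] (box × Fin 3 → ℂ) where
  toFun x := fun ka => L (gcoeffW Sγ x) ka.1 ka.2
  map_add' x₁ x₂ := by
    funext ka
    rw [gcoeffW_add, hadd]
    rfl
  map_smul' r x := by
    funext ka
    rw [gcoeffW_smul, hsmul]
    rfl

/-- The read-out evaluated. [cite: MagnenRivasseauSeneor1993, (II.68) p.344] -/
theorem readOutW_apply (Sγ : Finset Momentum) (box : Finset (Fin 4 → ℤ)) (L : GCoeff → GCoeff)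
    (hadd : ∀ η₁ η₂, L (η₁ + η₂) = L η₁ + L η₂) (hsmul : ∀ (r : ℝ) η, L (r • η) = r • L η)
    (x : ghostWindow Sγ → ℝ) (ka : box × Fin 3) :
    readOutW Sγ box L hadd hsmul x ka = L (gcoeffW Sγ x) ka.1 ka.2 := rfl

/-- **THE READ-OUT ON THE INDEPENDENT COORDINATES** (representatives `rep`, positive momenta; the window values are their
`±` copies by gen 6's `realifyWindow`): `readOut = readOutW ∘ realifyWindow`, `ℝ`-linear.
[cite: MagnenRivasseauSeneor1993, §II.A p.328 tl.12–17, (II.68) p.344] -/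
def readOut (Sγ : Finset Momentum) (box : Finset (Fin 4 → ℤ)) (L : GCoeff → GCoeff)
    (hadd : ∀ η₁ η₂, L (η₁ + η₂) = L η₁ + L η₂) (hsmul : ∀ (r : ℝ) η, L (r • η) = r • L η) :
    (↥((ghostWindow Sγ).image rep) → ℝ) →ₗ[ℝ] (box × Fin 3 → ℂ) where
  toFun y := readOutW Sγ box L hadd hsmul (realifyWindow ghostIm (ghostWindow Sγ) y)
  map_add' y₁ y₂ := by rw [realifyWindow_add, map_add]
  map_smul' r y := by rw [realifyWindow_smul, map_smul]; rfl

/-- The box part of a source `c`, flattened to `box × Fin 3`. [cite: MagnenRivasseauSeneor1993, (II.66) p.344] -/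
def boxVec (box : Finset (Fin 4 → ℤ)) (c : GCoeff) : box × Fin 3 → ℂ := fun ka => c ka.1 ka.2

/-- `sqNormBox` over the box as a `Fintype` sum over `box × Fin 3`. [cite: MagnenRivasseauSeneor1993, (II.64) p.344, §II.A p.328 tl.37–42] -/
theorem sqNormBox_eq_sum_prod (box : Finset (Fin 4 → ℤ)) (F : GCoeff) :
    sqNormBox box F = (1 / 2) * ∑ ka : box × Fin 3, Complex.normSq (F ka.1 ka.2) := by
  unfold sqNormBox
  rw [Fintype.sum_prod_type, Finset.sum_coe_sort box (fun k => ∑ a, Complex.normSq (F k a))]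

/-- **`sqNormBox box (L(γ̃) + c)` ON THE WINDOW COORDINATES**: `= ½ Σ_{(k,a)} |readOutW x (k,a) + c^a(k)|²`.
[cite: MagnenRivasseauSeneor1993, p.344 tl.27–29, (II.64) p.344] -/
theorem sqNormBox_linear_eq_window (Sγ : Finset Momentum) (box : Finset (Fin 4 → ℤ)) (L : GCoeff → GCoeff)
    (hadd : ∀ η₁ η₂, L (η₁ + η₂) = L η₁ + L η₂) (hsmul : ∀ (r : ℝ) η, L (r • η) = r • L η) (c : GCoeff)
    (x : ghostWindow Sγ → ℝ) :
    sqNormBox box (fun k => L (gcoeffW Sγ x) k + c k) =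
      (1 / 2) * ∑ ka : box × Fin 3, Complex.normSq ((readOutW Sγ box L hadd hsmul x + boxVec box c) ka) := by
  rw [sqNormBox_eq_sum_prod]
  rfl

/-- **THE MAIN QUADRATIC PIECE IN CLOSED FORM: `sqNormBox box (L(γ̃′) + c) = ½‖R y + d‖²`** at `γ̃′ = γ̃(realifyWindow y)`,
with the REAL matrix `R = reImMatrix readOut` and `d = reImVec (boxVec c)` — READING (U) of v1 discharged.
[cite: MagnenRivasseauSeneor1993, p.344 tl.27–29 «(ζ/2)⟨γ′ − γ, UᵗʳU(γ′ − γ)⟩ … we write U² for UᵗʳU», §II.A p.328 tl.37–42] -/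
theorem sqNormBox_linear_eq (Sγ : Finset Momentum) (box : Finset (Fin 4 → ℤ)) (L : GCoeff → GCoeff)
    (hadd : ∀ η₁ η₂, L (η₁ + η₂) = L η₁ + L η₂) (hsmul : ∀ (r : ℝ) η, L (r • η) = r • L η) (c : GCoeff)
    (y : ↥((ghostWindow Sγ).image rep) → ℝ) :
    sqNormBox box (fun k => L (gcoeffW Sγ (realifyWindow ghostIm (ghostWindow Sγ) y)) k + c k) =
      (1 / 2) * ((reImMatrix (readOut Sγ box L hadd hsmul) *ᵥ y + reImVec (boxVec box c)) ⬝ᵥ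
        (reImMatrix (readOut Sγ box L hadd hsmul) *ᵥ y + reImVec (boxVec box c))) := by
  rw [sqNormBox_linear_eq_window Sγ box L hadd hsmul c, ← sum_normSq_affine]
  rfl

/-- The window integrand is measurable: `x ↦ sqNormBox box (L(γ̃(x)) + c)` is continuous (a linear map of a finite-dimensional
space composed with `|·|²`). [cite: MagnenRivasseauSeneor1993, (II.66) p.344] -/
theorem measurable_sqNormBox_linear (Sγ : Finset Momentum) (box : Finset (Fin 4 → ℤ)) (L : GCoeff → GCoeff)
    (hadd : ∀ η₁ η₂, L (η₁ + η₂) = L η₁ + L η₂) (hsmul : ∀ (r : ℝ) η, L (r • η) = r • L η) (c : GCoeff) :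
    Measurable fun x : ghostWindow Sγ → ℝ => sqNormBox box (fun k => L (gcoeffW Sγ x) k + c k) := by
  have hcont : Continuous (readOutW Sγ box L hadd hsmul) :=
    (readOutW Sγ box L hadd hsmul).continuous_of_finiteDimensional
  have h : Continuous fun x : ghostWindow Sγ → ℝ =>
      (1 / 2 : ℝ) * ∑ ka : box × Fin 3, Complex.normSq ((readOutW Sγ box L hadd hsmul x + boxVec box c) ka) := by
    refine continuous_const.mul (continuous_finsetSum _ fun ka _ => ?_)
    exact Complex.continuous_normSq.comp (((continuous_apply ka).comp hcont).add continuous_const)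
  simp_rw [sqNormBox_linear_eq_window Sγ box L hadd hsmul c]
  exact h.measurable

/-! ## §6 (v1.1) (II.66) → (II.73) FOR THE PRINTED OPERATOR: the main quadratic piece of `K_{ρ₂}(A′, γ)` against the tree's
`dν_{ρ₂}`, with `U(A′_s, B′_l)` of (II.68) itself -/

/-- **THE MAIN PIECE AGAINST `dν_{ρ₂}`, ANY LINEAR `L`:** for a momentum window `Sγ` with live variances on the
representatives, a box, an additive `ℝ`-homogeneous `L`, a frozen source `c`, any `ζ` and measurable `F`,
`∫ e^{−(ζ/2)·sqNormBox box (L(γ̃′) + c)} F(γ′|_W) dν_{ρ₂}(γ′) = ∫dπ_{Γ⁻¹}(y) mainPiece (ζ/2) R d 0 y · F(realifyWindow y)` with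
`R = reImMatrix readOut`, `d = reImVec (boxVec c)`, `Γ⁻¹ = diag(Γ_{ρ₂}|_{rep W}⁻¹)` — v1's abstract `U` IS this `R` (and the
`½` of the p.328 pairing sits in `ζ/2`). [cite: MagnenRivasseauSeneor1993, (II.66) p.344 tl.13–15, p.344 tl.27–29, (II.36) p.339] -/
theorem integral_nu_expSqNormBox (par : Parameters) (ρ₂ : ℕ) (Sγ : Finset Momentum) (box : Finset (Fin 4 → ℤ))
    (L : GCoeff → GCoeff) (hadd : ∀ η₁ η₂, L (η₁ + η₂) = L η₁ + L η₂) (hsmul : ∀ (r : ℝ) η, L (r • η) = r • L η)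
    (c : GCoeff) (ζ : ℝ) (hv : ∀ m : ↥((ghostWindow Sγ).image rep), par.nuVariance ρ₂ m ≠ 0)
    {F : (ghostWindow Sγ → ℝ) → ℝ} (hF : Measurable F) :
    ∫ γ, Real.exp (-(ζ / 2) * sqNormBox box (fun k => L (gcoeffZ Sγ γ) k + c k)) *
        F ((ghostWindow Sγ).restrict γ) ∂(nu par ρ₂) =
      gaussExpect (diagInv fun m : ↥((ghostWindow Sγ).image rep) => par.nuVariance ρ₂ m)
        (fun y => mainPiece (ζ / 2) (reImMatrix (readOut Sγ box L hadd hsmul)) (reImVec (boxVec box c)) 0 y *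
          F (realifyWindow ghostIm (ghostWindow Sγ) y)) := by
  have hG : Measurable fun x : ghostWindow Sγ → ℝ =>
      Real.exp (-(ζ / 2) * sqNormBox box (fun k => L (gcoeffW Sγ x) k + c k)) * F x :=
    (Real.measurable_exp.comp ((measurable_sqNormBox_linear Sγ box L hadd hsmul c).const_mul _)).mul hF
  have h1 := integral_nu_window_rep par ρ₂ (ghostWindow Sγ) hv hG
  simp_rw [gcoeffZ_eq_gcoeffW]
  rw [h1]
  congr 1
  funext y
  rw [sqNormBox_linear_eq Sγ box L hadd hsmul c y, mainPiece, sub_zero]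
  congr 2
  ring

/-- **(II.73) FOR THE PRINTED QUADRATIC PIECE** (`ζ ≥ 0`): completing the square (gen 6's `gaussExpect_completing_square`)
turns the `dν_{ρ₂}(γ′)`-integral of `e^{−(ζ/2)·sqNormBox(L(γ̃′) + c)}·F` into `(Z(M)/Z(Γ⁻¹))·e^{Ω/2}·∫dπ_M(y) F(realifyWindow(y
− M⁻¹b))` with `M = (ζ/2)RᵀR + Γ⁻¹` (the print's `ζU² + Γ⁻¹`), `b = (ζ/2)Rᵀd`, `Ω` = (II.72) — the new Gaussian variable `γ″`
of (II.71) for the tree's measure and the printed operator. [cite: MagnenRivasseauSeneor1993, (II.71)–(II.73) p.345 tl.2–13] -/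
theorem integral_nu_expSqNormBox_eq_cs (par : Parameters) (ρ₂ : ℕ) (Sγ : Finset Momentum) (box : Finset (Fin 4 → ℤ))
    (L : GCoeff → GCoeff) (hadd : ∀ η₁ η₂, L (η₁ + η₂) = L η₁ + L η₂) (hsmul : ∀ (r : ℝ) η, L (r • η) = r • L η)
    (c : GCoeff) {ζ : ℝ} (hζ : 0 ≤ ζ) (hv : ∀ m : ↥((ghostWindow Sγ).image rep), par.nuVariance ρ₂ m ≠ 0)
    {F : (ghostWindow Sγ → ℝ) → ℝ} (hF : Measurable F) :
    ∫ γ, Real.exp (-(ζ / 2) * sqNormBox box (fun k => L (gcoeffZ Sγ γ) k + c k)) *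
        F ((ghostWindow Sγ).restrict γ) ∂(nu par ρ₂) =
      (gaussZ (csMat (ζ / 2) (reImMatrix (readOut Sγ box L hadd hsmul))
            (diagInv fun m : ↥((ghostWindow Sγ).image rep) => par.nuVariance ρ₂ m)) /
          gaussZ (diagInv fun m : ↥((ghostWindow Sγ).image rep) => par.nuVariance ρ₂ m)) *
        Real.exp (Omega (ζ / 2) (reImMatrix (readOut Sγ box L hadd hsmul))
          (diagInv fun m : ↥((ghostWindow Sγ).image rep) => par.nuVariance ρ₂ m) (reImVec (boxVec box c)) 0 / 2) *
        gaussExpect (csMat (ζ / 2) (reImMatrix (readOut Sγ box L hadd hsmul))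
            (diagInv fun m : ↥((ghostWindow Sγ).image rep) => par.nuVariance ρ₂ m))
          (fun y => F (realifyWindow ghostIm (ghostWindow Sγ)
            (y + (0 - (csMat (ζ / 2) (reImMatrix (readOut Sγ box L hadd hsmul))
              (diagInv fun m : ↥((ghostWindow Sγ).image rep) => par.nuVariance ρ₂ m))⁻¹ *ᵥ
                csVec (ζ / 2) (reImMatrix (readOut Sγ box L hadd hsmul))
                  (diagInv fun m : ↥((ghostWindow Sγ).image rep) => par.nuVariance ρ₂ m)
                  (reImVec (boxVec box c)) 0)))) := by
  set Γinv := diagInv fun m : ↥((ghostWindow Sγ).image rep) => par.nuVariance ρ₂ m with hΓ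
  have hPD : Γinv.PosDef := posDef_diagInv _ hv
  have hζ' : 0 ≤ ζ / 2 := by positivity
  rw [integral_nu_expSqNormBox par ρ₂ Sγ box L hadd hsmul c ζ hv hF]
  simp only [mainPiece]
  exact gaussExpect_completing_square (ζ / 2) _ (isSymm_of_posDef' hPD) (isUnit_det_csMat hζ' _ hPD)
    (gaussZ_pos (posDef_csMat hζ' _ hPD)).ne' _ 0 _

/-- **THE NORMALISATION OF THE PRINTED QUADRATIC PIECE** (`F ≡ 1`, `ζ ≥ 0`):
`∫ e^{−(ζ/2)·sqNormBox(L(γ̃′) + c)} dν_{ρ₂}(γ′) = (det(1 + (ζ/2)ΓRᵀR))^{−1/2}·e^{Ω/2}` — p.345 tl.14–17 «(det(1 + ζΓU²))^{1/2} … the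
analogue of the Fadeev-Popov determinant» for the tree's `dν_{ρ₂}` and a linear `L` (in particular `U(A′_s,B′_l)`).
[cite: MagnenRivasseauSeneor1993, p.345 tl.14–17, (II.73) p.345] -/
theorem integral_nu_expSqNormBox_eq_det (par : Parameters) (ρ₂ : ℕ) (Sγ : Finset Momentum) (box : Finset (Fin 4 → ℤ))
    (L : GCoeff → GCoeff) (hadd : ∀ η₁ η₂, L (η₁ + η₂) = L η₁ + L η₂) (hsmul : ∀ (r : ℝ) η, L (r • η) = r • L η)
    (c : GCoeff) {ζ : ℝ} (hζ : 0 ≤ ζ) (hv : ∀ m : ↥((ghostWindow Sγ).image rep), par.nuVariance ρ₂ m ≠ 0) :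
    ∫ γ, Real.exp (-(ζ / 2) * sqNormBox box (fun k => L (gcoeffZ Sγ γ) k + c k)) ∂(nu par ρ₂) =
      (Real.sqrt (Matrix.det (1 + (ζ / 2) •
          ((diagInv fun m : ↥((ghostWindow Sγ).image rep) => par.nuVariance ρ₂ m)⁻¹ *
            ((reImMatrix (readOut Sγ box L hadd hsmul))ᵀ * reImMatrix (readOut Sγ box L hadd hsmul))))))⁻¹ *
        Real.exp (Omega (ζ / 2) (reImMatrix (readOut Sγ box L hadd hsmul))
          (diagInv fun m : ↥((ghostWindow Sγ).image rep) => par.nuVariance ρ₂ m) (reImVec (boxVec box c)) 0 / 2) := by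
  set Γinv := diagInv fun m : ↥((ghostWindow Sγ).image rep) => par.nuVariance ρ₂ m with hΓ
  have hPD : Γinv.PosDef := posDef_diagInv _ hv
  have hζ' : 0 ≤ ζ / 2 := by positivity
  have h := integral_nu_expSqNormBox_eq_cs par ρ₂ Sγ box L hadd hsmul c hζ hv (F := fun _ => (1 : ℝ)) measurable_const
  simp only [mul_one] at h
  rw [h, gaussExpect_one (gaussZ_pos (posDef_csMat hζ' _ hPD)).ne', mul_one, gaussZ_ratio hζ' _ hPD,
    det_csMat_mul_propagator (ζ / 2) _ (isUnit_iff_ne_zero.mpr hPD.det_pos.ne')]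

/-! ### The instance `L = U(A′_s, B′_l)` of (II.68) -/

section UOp

variable (par : Parameters) (Nlow : ℕ → ℕ)

/-- `U(A′_s, B′_l)` of (II.68) as an operator on coefficient functions. [cite: MagnenRivasseauSeneor1993, (II.68) p.344 tl.19] -/
def uOpFun (T : Finset (Fin 4 → ℤ)) (ρ₁ : ℕ) (lam : ℝ) (A' B' : VCoeff) : GCoeff → GCoeff :=
  fun η k => uOp par Nlow T ρ₁ lam A' B' η k

/-- `U` is additive (gen 5's `uOp_add`). [cite: MagnenRivasseauSeneor1993, (II.68) p.344 tl.19, tl.27–29] -/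
theorem uOpFun_add (T : Finset (Fin 4 → ℤ)) (ρ₁ : ℕ) (lam : ℝ) (A' B' : VCoeff) (η₁ η₂ : GCoeff) :
    uOpFun par Nlow T ρ₁ lam A' B' (η₁ + η₂) = uOpFun par Nlow T ρ₁ lam A' B' η₁ + uOpFun par Nlow T ρ₁ lam A' B' η₂ := by
  funext k
  exact uOp_add par Nlow T ρ₁ lam A' B' η₁ η₂ k

/-- `U` is `ℝ`-homogeneous (gen 5's `uOp_smul` at a real scalar). [cite: MagnenRivasseauSeneor1993, (II.68) p.344 tl.19, tl.27–29] -/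
theorem uOpFun_smul (T : Finset (Fin 4 → ℤ)) (ρ₁ : ℕ) (lam : ℝ) (A' B' : VCoeff) (r : ℝ) (η : GCoeff) :
    uOpFun par Nlow T ρ₁ lam A' B' (r • η) = r • uOpFun par Nlow T ρ₁ lam A' B' η := by
  have hr : (r • η : GCoeff) = ((r : ℂ) • η) := by
    funext k a
    simp [Complex.real_smul]
  funext k
  show uOp par Nlow T ρ₁ lam A' B' (r • η) k = r • uOp par Nlow T ρ₁ lam A' B' η k
  rw [hr, uOp_smul]
  funext a
  simp [Complex.real_smul]

/-- **(II.66) → (II.73) FOR `U(A′_s, B′_l)` ITSELF**: the main quadratic piece `e^{−(ζ/2)(U(A′_s,B′_l)γ̃′ + c)²}` of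
`K_{ρ₂}(A′, γ)` (box `box4 T`, `ζ = par.ζ`, frozen source `c` — in print `∇_{RB,γ′−γ}·A′_s − U γ̃`) against the tree's
`dν_{ρ₂}(γ′)` IS v1's `mainPiece (ζ/2) R d 0` on the independent coordinates with the EXPLICIT real matrix
`R = reImMatrix (readOut Sγ (box4 T) U)`. [cite: MagnenRivasseauSeneor1993, (II.66)–(II.68) p.344, p.344 tl.27–29] -/
theorem integral_nu_expSqNormBox_uOp (ρ₂ : ℕ) (Sγ : Finset Momentum) (T : Finset (Fin 4 → ℤ)) (ρ₁ : ℕ) (lam : ℝ)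
    (A' B' : VCoeff) (c : GCoeff) (hv : ∀ m : ↥((ghostWindow Sγ).image rep), par.nuVariance ρ₂ m ≠ 0)
    {F : (ghostWindow Sγ → ℝ) → ℝ} (hF : Measurable F) :
    ∫ γ, Real.exp (-(par.ζ / 2) * sqNormBox (box4 T) (fun k => uOp par Nlow T ρ₁ lam A' B' (gcoeffZ Sγ γ) k + c k)) *
        F ((ghostWindow Sγ).restrict γ) ∂(nu par ρ₂) =
      gaussExpect (diagInv fun m : ↥((ghostWindow Sγ).image rep) => par.nuVariance ρ₂ m)
        (fun y => mainPiece (par.ζ / 2)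
          (reImMatrix (readOut Sγ (box4 T) (uOpFun par Nlow T ρ₁ lam A' B')
            (uOpFun_add par Nlow T ρ₁ lam A' B') (uOpFun_smul par Nlow T ρ₁ lam A' B')))
          (reImVec (boxVec (box4 T) c)) 0 y * F (realifyWindow ghostIm (ghostWindow Sγ) y)) :=
  integral_nu_expSqNormBox par ρ₂ Sγ (box4 T) (uOpFun par Nlow T ρ₁ lam A' B') (uOpFun_add par Nlow T ρ₁ lam A' B')
    (uOpFun_smul par Nlow T ρ₁ lam A' B') c par.ζ hv hF

/-- **… and its normalisation in the printed determinant form** for `U(A′_s, B′_l)` (`ζ ≥ 0`):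
`∫ e^{−(ζ/2)(U(A′_s,B′_l)γ̃′ + c)²} dν_{ρ₂}(γ′) = (det(1 + (ζ/2)ΓRᵀR))^{−1/2}·e^{Ω/2}` — the factor of `K_{ρ₂}(A′,γ)⁻¹` that is «the
analogue of the Fadeev-Popov determinant» (p.345 tl.14–17), for the tree's measure and the printed `U`.
[cite: MagnenRivasseauSeneor1993, p.345 tl.14–17, (II.68) p.344, (II.73) p.345] -/
theorem integral_nu_expSqNormBox_uOp_eq_det (ρ₂ : ℕ) (Sγ : Finset Momentum) (T : Finset (Fin 4 → ℤ)) (ρ₁ : ℕ)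
    (lam : ℝ) (A' B' : VCoeff) (c : GCoeff) (hζ : 0 ≤ par.ζ)
    (hv : ∀ m : ↥((ghostWindow Sγ).image rep), par.nuVariance ρ₂ m ≠ 0) :
    ∫ γ, Real.exp (-(par.ζ / 2) * sqNormBox (box4 T) (fun k => uOp par Nlow T ρ₁ lam A' B' (gcoeffZ Sγ γ) k + c k))
        ∂(nu par ρ₂) =
      (Real.sqrt (Matrix.det (1 + (par.ζ / 2) •
          ((diagInv fun m : ↥((ghostWindow Sγ).image rep) => par.nuVariance ρ₂ m)⁻¹ *
            ((reImMatrix (readOut Sγ (box4 T) (uOpFun par Nlow T ρ₁ lam A' B')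
                (uOpFun_add par Nlow T ρ₁ lam A' B') (uOpFun_smul par Nlow T ρ₁ lam A' B')))ᵀ *
              reImMatrix (readOut Sγ (box4 T) (uOpFun par Nlow T ρ₁ lam A' B')
                (uOpFun_add par Nlow T ρ₁ lam A' B') (uOpFun_smul par Nlow T ρ₁ lam A' B')))))))⁻¹ *
        Real.exp (Omega (par.ζ / 2)
          (reImMatrix (readOut Sγ (box4 T) (uOpFun par Nlow T ρ₁ lam A' B')
            (uOpFun_add par Nlow T ρ₁ lam A' B') (uOpFun_smul par Nlow T ρ₁ lam A' B')))
          (diagInv fun m : ↥((ghostWindow Sγ).image rep) => par.nuVariance ρ₂ m) (reImVec (boxVec (box4 T) c)) 0 / 2) :=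
  integral_nu_expSqNormBox_eq_det par ρ₂ Sγ (box4 T) (uOpFun par Nlow T ρ₁ lam A' B')
    (uOpFun_add par Nlow T ρ₁ lam A' B') (uOpFun_smul par Nlow T ρ₁ lam A' B') c hζ hv

end UOp

end GhostWindow

end MainStatement

end Literature.MathematicalPhysics.QuantumFieldTheory.MagnenRivasseauSeneor1993
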